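import Mathlib
import HarnessLib
import HarnessLib.Audit
import Summits.MatrixMultiplication.Statement
import Summits.MatrixMultiplication.MatrixMultiplication.Theorems.GraphEquationsCoeffIdentity
import Summits.MatrixMultiplication.MatrixMultiplication.Theorems.GraphEquationsExponentOne
import HarnessLib.Audit.Status.Attr

/-!
Route: GraphEquations

# Route GraphEquations — omega=2 iff the graph of matrix multiplication has quadratic-cost equations
and multiplicity reduces

It suffices to show X = V ∧ H_mult for the GRAPH W_n = {(A,B,C) ∈ ℂ^{3n²} | C = AB} of n × n matrix
multiplication viewed as a DECISION problem (Bürgisser–Clausen–Shokrollahi, Problem 16.3): an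
equation system
for W_n is a division-free fan-in-two arithmetic circuit on the 3n² coordinates with a list of gate
values
(«tests») whose common zero set is exactly W_n (`EqSystem`, `EqSystem.Correct`, landed in
`Theorems/GraphEquationsSystems`); `EqAdmissible β` / `EqAdmissibleRed β` say correct (resp. correct
and
GENERICALLY REDUCED: C-Jacobian of the tests of rank n² at some point of W_n) systems of cost O(n^β)
exist for
all n ≥ 1. V = GraphEquationsQuadratic («the graph has equations of every cost exponent β > 2», the
declared
RESIDUAL conjunct) and H_mult = MultiplicityReduction («cheap equations can be made generically
reduced at
sub-polynomial loss», the ATTACKED conjunct). Both are NECESSARY (kernels `nec_quadratic`,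
`nec_multiplicityReduction`) and S ⟺ V ∧ H_mult EXACTLY: `summit_iff_split : S ↔ V ∧ H_red ∧ H_mult`
(M3) with the
reduced branch H_red now a THEOREM (`reducedEquationsForceMultiplication_holds`, M5, via the proved
`coeffIdentity`).
Cut a5 of the cell (writer NOTE/DECISION STATUS l.1283, critic PRE-CLEARED l.1287); no idea card is
realised (lens-born
node N5²³ of decomp-mm).
Lean: `(∀ β : ℝ, 2 < β →
Summit.MatrixMultiplication.MatrixMultiplication.Theorems.GraphEquations.EqAdmissible β) ∧ (∀ β : ℝ,
2 ≤ β → Summit.MatrixMultiplication.MatrixMultiplication.Theorems.GraphEquations.EqAdmissible β → ∀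
β' : ℝ, β < β' →
Summit.MatrixMultiplication.MatrixMultiplication.Theorems.GraphEquations.EqAdmissibleRed β')`

## Assembly
Pure logic over landed kernels: V gives EqAdmissible β for every β > 2; H_mult upgrades to
EqAdmissibleRed β' for every
β' > β; the THEOREM H_red (`reducedEquationsForceMultiplication_holds`, M5 over M4's truncation
kernel) gives ω ≤ β';
density of ℝ and `omega_two_le ℂ` give ω = 2 and `MatrixMultiplication_iff` the summit — packaged as
`matrixMultiplication_of_quadratic_of_multiplicityReduction : V → H_mult → S` (M5). The deciding
theorem of glue.lean is
`closes (hV : GraphEquationsQuadratic) (hM : MultiplicityReduction) : _root_.MatrixMultiplication :=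
that kernel hV hM`.
Exactness: `summit_iff_split : S ↔ V ∧ H_red ∧ H_mult` (M3) with H_red proved, so S ⟺ V ∧ H_mult.

Rationale: WHY THIS LINE. The mechanism is DECISION VERSUS COMPUTATION for the graph W_n
(BurgisserClausenShokrollahi1997, Problem 16.3, open
since 1992/1997; arXiv:1806.09189, Künnemann 2018, p.3/p.19: even deterministic O(n²) verification
of AB = C is open
and no relative lower bound is known): ω = 2 iff W_n has correct equation systems of every cost
exponent β > 2 (V) and
equations are never asymptotically cheaper than multiplication (H); H splits as H_red ∧ H_mult and
the REDUCED branch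
H_red is now closed in the kernel: Strassen's substitution–truncation at a generically reduced point
of W_n
(Strassen1973; BurgisserClausenShokrollahi1997 Prop. (14.1)/(14.8); tree
`exists_triads_of_isNonscalarSeq`,
W_n-automorphism `linCoeffC_bind₁_shift`) plus the coefficient identity `coeffIdentity` (M5: for t
vanishing on W_n,
coeff_{a_ij b_j'l} t = −[j = j'] coeff_{c_il} t, proved by the two-parameter probe (sE_ij, uE_j'l,
[j=j'] suE_il) ⊂ W_n
and `MvPolynomial.funext`) give `reducedSystemsCostRankCost_holds`: a correct, generically reduced
system with N
gates has R(⟨n,n,n⟩) ≤ 2N, hence `reducedEquationsForceMultiplication_holds : H_red`. What remains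
is MULTIPLICITY
REDUCTION H_mult — whether cheap but highly non-reduced tests (members of g·𝕀(W_n)^M for large M)
can be traded for
reduced ones at loss n^{o(1)} — imported from commutative algebra as an EXPONENT LADDER
(Nullstellensatz / Loewy
exponent of the test ideal against 𝕀(W_n); derivative rounds). No prior route of the summit and
nothing in the
negatives index (12 refuted statements) uses W_n as a decision problem or compares the cost of
EQUATIONS FOR THE GRAPH
with ω; lens-3's «equations» (ObstructionDescent/LinearSolveSplit) are polynomials vanishing on
secant varieties —
different variety, role and open problem (16.1 vs 16.3).

RANKED CRUXES. #2 MultiplicityReduction (crux) — H_mult — multiplicity reduction, the ATTACKED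
conjunct: for every real β ≥ 2, if correct equation systems for W_n of cost O(n^β) exist for all n ≥
1, then for every β' > β correct GENERICALLY REDUCED systems of cost O(n^{β'}) exist. NEC of the
trivial kind (S ⇒ EqAdmissibleRed β' for every β' > 2: kernel `nec_multiplicityReduction`); with
H_red a theorem, H_mult ⟺ H (`equationsForceMultiplication_of_multiplicityReduction`, M5). NOT
VACUOUS (nowhere-reduced correct systems exist at every n, e.g. the squared generator system {(c_il
− (AB)_il)²}; the question is whether non-reduced systems can be cheaper — at n = 2 they cannot:
census I68, min prodCount = 7 for every correct system, argument endorsed by the critic l.1298).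
IDEA-NEEDED; line of record = the BC3 skeleton «exponent ladder»
(bc/MultiplicityReduction_birth.lean): ExponentBound (cheap families of BOUNDED Loewy exponent M:
g·𝕀(W_n)^M ⊆ (tests), g ∉ 𝕀(W_n)) → ExponentDescent (bounded exponent ⇒ exponent one at cost
O(n^{β+ε})) → ExponentOneReduced (exponent one ⇒ generically reduced: PROVED,
`exponentOneReduced_holds`, M6 — the BC5 rung of this crux). [difficulty: open-problem] (why it
might fail: Tests in g·𝕀(W_n)^M with M = n^δ might be computable at quadratic cost (a genuinely new
verification algorithm); derivative/syzygy rounds then lose a factor poly(M) = n^{O(δ)} and the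
implication fails as typed for β' < β + O(δ).) [BurgisserClausenShokrollahi1997, arXiv:1806.09189,
Strassen1973]
#3 GraphEquationsQuadratic (crux) — V — the graph has equations of every super-quadratic cost: for
every β > 2 there are correct equation systems for W_n of cost O(n^β), n ≥ 1. NEC (kernel
`nec_quadratic`, unconditional via the tree's proved BCS Prop. (15.1): compute AB in O(n^{ω+ε}) and
append the n² tests c_il − (AB)_il); WEAKER-UNDECIDED; IDEA-NEEDED; INSTRUMENTABLE at n = 2, 3
(census: at n = 2 every correct system needs exactly L(⟨2,2,2⟩) = 7 products — census I68,
critic-endorsed). Declared RESIDUAL conjunct of the exact split S ⟺ V ∧ H_mult (tribunal `--residual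
GraphEquationsQuadratic`). [difficulty: open-problem] (why it might fail: If ω > 2 then, H_red being
a theorem and H_mult plausible, V is false: correct systems would need cost n^{ω−o(1)}; no
construction idea beyond computing AB itself is known (Künnemann 2018 p.3).)
[BurgisserClausenShokrollahi1997, arXiv:1806.09189]

TWO-LAYER PLAN. The registered BC3 skeleton of the attacked crux is the foreseen glued split (`route
edit --split MultiplicityReduction --into
ExponentBound ExponentDescent --glue MultiplicityReduction_of`, the third leg ExponentOneReduced
being the THEOREM
`exponentOneReduced_holds`, M6): H_mult ⇐ ExponentBound (for every admissible β and β' > β some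
family of cost O(n^{β'}) has
BOUNDED Loewy exponent M — the open core) → ExponentDescent (bounded exponent M ⇒ exponent one at
cost O(n^{β+ε}):
derivative rounds on flat syzygies, theorem-candidate modulo the circuit cost of syzygy
coefficients) → ExponentOneReduced
(PROVED) → H_mult (composition kernel-checked in the skeleton, midpoint exponent). Nothing of this
is filed now.

KILL CRITERIA. (K1) ¬MultiplicityReduction by an explicit uniform family of quadratic-cost
non-reduced correct systems ⇒ re-type H_mult
with the measured loss (pivot, not close); the n = 2 early-warning proxy (LoopholeAtTwo) came back
NEGATIVE by argument (census I68:
no correct system for W_2 below 7 products), the n = 3 proxy I-g23b is next. (K2) ¬ExponentDescent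
for some fixed M (a bounded-exponent family
whose flat syzygies provably need super-polynomial circuits) kills the exponent-ladder LINE, not the
route (back to
crux-ideate on H_mult). (K3) ¬V is S-hard to certify (needs ω > 2) — not a kill test. ω = 2 proved
elsewhere moots the
route (both conjuncts follow: `nec_quadratic`, `nec_multiplicityReduction`).

NOT DECOMPOSED YET. MultiplicityReduction is deliberately ONE route node at open (its skeleton — two
open stubs ExponentBound, ExponentDescent over
the proved rung ExponentOneReduced — is registered as a LINE; the glued split is a tenure decision);
the closed reduced branch
(CoeffIdentity, ReducedSystemsCostRankCost, ReducedEquationsForceMultiplication — theorems of M5),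
the proved rung
ExponentOneReduced (`exponentOneReduced_holds`, M6) and the n = 2 instruments LoopholeAtTwo /
ReducedNeedsSeven (landed
decls of M3, census-owned) are NOT filed as items (BC6: nothing outside the cone of `closes`); the
Krull/codimension
floor «EqAdmissible β → 2 ≤ β» is not claimed (not needed by `closes`).

CHEAPEST FALSIFIER. n = 2 instrument I-g23a LoopholeAtTwo («a correct system for W_2 with ≤ 6
product gates», landed decl, M3): SETTLED BY ARGUMENT — census
decomp-mm-census-1 g19 row I68 (proof-by-argument, STATUS l.1291, census/data/I68-SUMMARY-v19.md;
critic RE-DERIVED and ENDORSED l.1298): every correct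
division-free fan-in-two system for W_2 has prodCount ≥ 7 = L(⟨2,2,2⟩), minimum EXACTLY 7 — «H at n
= 2» holds as an instance, no loophole
at n = 2 (consistent with H_mult; kills nothing). H_mult is NOT VACUOUS: nowhere-reduced correct
systems exist at every n (squared generator
system {(c_il − (AB)_il)²}: C-Jacobian ≡ 0 on W_n), so EqAdmissible is a larger hypothesis class
than EqAdmissibleRed; open is only whether
such systems can be CHEAPER. Next instrument (writer a6.3): I-g23b, n = 3 vs R(⟨3,3,3⟩) ∈ [19, 23].
Probes run (g24, bc/, against M1–M5):
`V → S`, `H_mult → S`, every open skeleton stub → H_mult / → S by `exact? | simpa | aesop` all FAIL;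
BC7 V / H_mult CLEAN; `S → V`, `S → H_mult` close only through the kernels nec_*.

NUMBERS. ω(ℂ) < 2.48 in tree (`BCS1997_cor_15_33`, hence `eqAdmissibleRed_five_halves :
EqAdmissibleRed (5/2)` landed — the
hypotheses of H_mult are inhabited at β = 5/2); L(⟨2,2,2⟩) = R(⟨2,2,2⟩) = 7 (Winograd1971; BCS Thm.
(17.12)); R(⟨3,3,3⟩)
∈ [19, 23]; generically reduced correct systems with N gates have R(⟨n,n,n⟩) ≤ 2N (THEOREM
`reducedSystemsCostRankCost_holds`);
Bürgisser–Lickteig column bound for W_n = n² (trivial; BCS p.318); best deterministic verification =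
compute AB, randomized
O(n²) (Freivalds; Künnemann 2018 p.3).

DEFINITION REQUESTS. None: `EqSystem`, `Correct`, `cost`, `prodCount`, `jacobianC`,
`GenericallyReduced`, `EqAdmissible(Red)`, `mmGraph`,
`CoeffIdentity` (+ its proof) and the exponent-one rung are landed in
`Theorems/GraphEquationsSystems|Generators|Kernel|CostRank|
CoeffIdentity|ExponentOne`; the exponent condition is typed inline with Mathlib's
`MvPolynomial.vanishingIdeal` and `Ideal.span`.
Cite fact wanted (not blocking): Bürgisser–Lickteig, JPAA 81 (1992) 247–267 (acq-14950) for the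
column bound.

Novelty: Searches (2026-08-30/31): lit search «verification complexity matrix multiplication lower bound» /
«verifying matrix product deterministic n^2» / «graph of matrix multiplication equations complexity»
(corpus fts+hybrid: 2 relevant items — [corpus:book:burgisser1997 p.318, p.483],
[corpus:arxiv-1806.09189 p.3, p.5, p.19]); lit galaxy search "verification complexity|verifying
matrix" --star all (BCS scan [galaxy:panama:246556892594224] + Freivalds/Künnemann-type algorithmic
pages, no relative lower bound); «truncation verification bilinear rank», «symbolic power graph
ideal straight-line program», «deflation multiplicity straight-line program» (corpus+galaxy: no
hits); lit read book:burgisser1997-algebraic-complexity-theory pp. 386/388 (Prop. (14.1), (14.8)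
confirmed); ledger negatives --problem MatrixMultiplication (12, none related); lean search
EqSystem|mmGraph|vanishingIdeal (tree: nothing before Stage 1; Mathlib
`MvPolynomial.vanishingIdeal`).
Nearest prior art found: BurgisserClausenShokrollahi1997 Problem 16.3 (p.483: the
decision-complexity-of-W_n question, OPEN) and p.318 (Lickteig: C*(SL_n) ≥ c·R̲(⟨n,n,n⟩), the
sibling relative bound for {det = 1}; Bürgisser–Lickteig column bound = n² for W_n, trivial);
arXiv:1806.09189 (Künnemann 2018: deterministic O(n²) verification open, best deterministic =
compute AB).
Delta: the exact typed split S ⟺ V ∧ H_mult with the reduced branch PROVED (generically reduced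
correct systems with N gates give R(⟨n,n,n⟩) ≤ 2N, kernel-checked)  [refs: 1806.09189, book:burgisser1997, arxiv-1806.09189, book:burgisser1997-algebraic-complexity-theory, BurgisserClausenShokrollahi1997]

Barriers (technique_class: algebraic-complexity, polynomial-method, truncation): - technique_class: algebraic-complexity, polynomial-method, truncation
- Literature.Barriers.MatrixMultiplication.UniversalMethodBarrier: outside its class — it quantifies
over bilinear ALGORITHM-DESIGN methods (degenerations of a fixed tensor); V is an existence claim
for a different task (deciding W_n) and H_mult / H_red are statements about equation systems and a
RELATIVE bound (2·cost ≥ R(⟨n,n,n⟩)), not upper-bound methods.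
- Literature.Barriers.MatrixMultiplication.IrreversibilityBarrier: outside — no intermediate tensor
is degenerated; the only tensor inequality used (in the proved branch) is R((id⊗id⊗Q)T) ≥ R(T) for
injective Q.
- Literature.Barriers.MatrixMultiplication.LinearRankMethodBarrier: outside — no absolute
(border-)rank lower bound is claimed; the proved branch transfers circuit cost to tensor rank, and
H_mult / V concern equation systems, so rank-method caps do not quantify over them.
- Literature.Barriers.MatrixMultiplication.TricoloredSumFreeBarrier: outside — no group-theoretic or
STPP construction (also YoungSubgroupBarrier, NilpotentGroupBarrier, QuasirandomBarrier,
NormalizerBarrier: not in the technique class).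
- Literature.Barriers.MatrixMultiplication.InfimumNotMinimumBarrier: honoured by typing — V and
H_mult quantify over exponents β > 2 / β' > β with O(n^β) families, never over «cost exactly n²»;
`closes` uses density of ℝ, not attainment.
- Literature.Barriers.MatrixMultiplication.RectangularBarrier: does not apply — only square ⟨n,n,n⟩
occurs.

sub-problem: MatrixMultiplication · status: draft · opened operator:999:2880194 2026-08-31T04:15:59Z · rev 1 · ledger route-MatrixMultiplication-GraphEquations
GENERATED by the gate from the ledger (D-0016/17). Provers cite these decls: `theorem foo : Summit.MatrixMultiplication.MatrixMultiplication.Theses.GraphEquations.<Decl> := …` in Summits/MatrixMultiplication/MatrixMultiplication/Theorems/<Name>.lean.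
-/

namespace Summit.MatrixMultiplication.MatrixMultiplication.Theses.GraphEquations

open scoped BigOperators Topology Manifold Classical MeasureTheory ProbabilityTheory Matrix InnerProductSpace ComplexConjugate ContinuousMap
open Filter Set Function TopologicalSpace MeasureTheory

attribute [summit_statement] _root_.MatrixMultiplication

/-- item stmt-MatrixMultiplication-27806 · crux · leaf IDEA-NEEDED · rank 2 · open · by operator
why it might fail: Tests in g·𝕀(W_n)^M with M = n^δ might be computable at quadratic cost (a genuinely new verification algorithm); derivative/syzygy rounds then lose a factor poly(M) = n^{O(δ)} and the implication fails as typed for β' < β + O(δ).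
sources: BurgisserClausenShokrollahi1997, arXiv:1806.09189, Strassen1973
[crux] H_mult — multiplicity reduction, the ATTACKED conjunct: for every real β ≥ 2, if correct
equation systems for W_n of cost O(n^β) exist for all n ≥ 1, then for every β' > β correct
GENERICALLY REDUCED systems of cost O(n^{β'}) exist. NEC of the trivial kind (S ⇒ EqAdmissibleRed β'
for every β' > 2: kernel `nec_multiplicityReduction`); with H_red a theorem, H_mult ⟺ H
(`equationsForceMultiplication_of_multiplicityReduction`, M5). NOT VACUOUS (nowhere-reduced correct
systems exist at every n, e.g. the squared generator system {(c_il − (AB)_il)²}; the question is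
whether non-reduced systems can be cheaper — at n = 2 they cannot: census I68, min prodCount = 7 for
every correct system, argument endorsed by the critic l.1298). IDEA-NEEDED; line of record = the BC3
skeleton «exponent ladder» (bc/MultiplicityReduction_birth.lean): ExponentBound (cheap families of
BOUNDED Loewy exponent M: g·𝕀(W_n)^M ⊆ (tests), g ∉ 𝕀(W_n)) → ExponentDescent (bounded exponent ⇒
exponent one at cost O(n^{β+ε})) → ExponentOneReduced (exponent one ⇒ generically reduced: PROVED,
`exponentOneReduced_holds`, M6 — the BC5 rung of this crux). [difficulty: open-problem] -/
@[route_item "route-MatrixMultiplication-GraphEquations", crux (bottleneck := idea) (source := "ledger D-0171 leaf tag IDEA-NEEDED on stmt-MatrixMultiplication-27806, 2026-09-01")]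
def MultiplicityReduction : Prop :=
  ∀ β : ℝ, 2 ≤ β → Summit.MatrixMultiplication.MatrixMultiplication.Theorems.GraphEquations.EqAdmissible β → ∀ β' : ℝ, β < β' → Summit.MatrixMultiplication.MatrixMultiplication.Theorems.GraphEquations.EqAdmissibleRed β'

/-- item stmt-MatrixMultiplication-27807 · crux · RESIDUAL (gen 0; summit-strength until shown otherwise, D-0170) · leaf IDEA-NEEDED · rank 3 · open · by operator
why it might fail: If ω > 2 then, H_red being a theorem and H_mult plausible, V is false: correct systems would need cost n^{ω−o(1)}; no construction idea beyond computing AB itself is known (Künnemann 2018 p.3).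
sources: BurgisserClausenShokrollahi1997, arXiv:1806.09189
[crux] V — the graph has equations of every super-quadratic cost: for every β > 2 there are correct
equation systems for W_n of cost O(n^β), n ≥ 1. NEC (kernel `nec_quadratic`, unconditional via the
tree's proved BCS Prop. (15.1): compute AB in O(n^{ω+ε}) and append the n² tests c_il − (AB)_il);
WEAKER-UNDECIDED; IDEA-NEEDED; INSTRUMENTABLE at n = 2, 3 (census: at n = 2 every correct system
needs exactly L(⟨2,2,2⟩) = 7 products — census I68, critic-endorsed). Declared RESIDUAL conjunct of
the exact split S ⟺ V ∧ H_mult (tribunal `--residual GraphEquationsQuadratic`). [difficulty: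
open-problem] -/
@[route_item "route-MatrixMultiplication-GraphEquations", crux (bottleneck := idea) (source := "ledger wanted_by.residual on stmt-MatrixMultiplication-27807, 2026-09-01")]
def GraphEquationsQuadratic : Prop :=
  ∀ β : ℝ, 2 < β → Summit.MatrixMultiplication.MatrixMultiplication.Theorems.GraphEquations.EqAdmissible β

/-- item stmt-MatrixMultiplication-27808 · assembly · rank 1 · open · by operator
sources: BurgisserClausenShokrollahi1997
[assembly] V → H_mult → ω(ℂ) = 2 (the summit `_root_.MatrixMultiplication`); the optional assembly
item (schema), realised by `closes`. -/
@[route_item "route-MatrixMultiplication-GraphEquations"]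
def Assembly : Prop :=
  GraphEquationsQuadratic → MultiplicityReduction → _root_.MatrixMultiplication

/-! D-0027 §2.1 — DECIDING THEOREM (planner-authored via `route open/edit --closes-file`; by operator:999:2880194 2026-08-31T04:15:59Z):
its hypotheses are this route's items and its conclusion the sub-problem Statement (glue_lint), and it elaborates with this file. -/

@[closes "route-MatrixMultiplication-GraphEquations"] theorem closes (hV : GraphEquationsQuadratic) (hM : MultiplicityReduction) :
    _root_.MatrixMultiplication :=
  Summit.MatrixMultiplication.MatrixMultiplication.Theorems.GraphEquations.matrixMultiplication_of_quadratic_of_multiplicityReduction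
    hV hM

end Summit.MatrixMultiplication.MatrixMultiplication.Theses.GraphEquations
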